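import Mathlib
import Summits.AnomalousDissipation.AnomalousDissipation.Theses.ImpulseGrid
import Literature.Analysis.FluidPDE.LinearizedNSTorus
import Literature.Analysis.FluidPDE.TorusClassicalLerayHopfProofs
import Literature.Analysis.FluidPDE.LongTimeAveragePeriodic

/-!
# Sketch — crux idea `columnar-collapse-steady-branch` for `ImpulseGrid.BoundedEnergyGrid`
(crux-ideate round 1, ideator 2, planner-cruxidea-stmt-AnomalousDissipation-10430-2-0).

The unit-mass clause `∫ Φ = 1` admits the constant profile `Φ ≡ 1`; then `f = G(x⊥)` is columnar and
`u = c e₀ + V(x⊥)` with `V` a zero-mean planar steady state of `NS_ν(G)` is an exact steady state with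
momentum `c e₀` (`c ∂₀ V = 0`). Steady states are their own Leray–Hopf data. So the archived planar
C⁺ `BoundedSteadyBranch` of the moot crux `TwoAndHalfD.TwodBoundedEnergyZeroMomentum` decides this crux.
Signatures + the first lemma (proved); `sorry` only in the two lift lemmas (folder sketch).
-/

namespace Summit.AnomalousDissipation.AnomalousDissipation.Cruxes.BoundedEnergyGrid.ColumnarCollapse

open MeasureTheory Filter
open Literature.Analysis.FunctionSpaces Literature.Analysis.FluidPDE

local notation "𝕋³" => UnitAddTorus (Fin 3)
local notation "E³" => EuclideanSpace ℝ (Fin 3)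
local notation "𝕋²" => UnitAddTorus (Fin 2)
local notation "E²" => EuclideanSpace ℝ (Fin 2)

/-- **C⁺₃ (steady grid branch).** The design clauses of `BoundedEnergyGrid` verbatim, and — in place of
the Leray–Hopf family — STEADY smooth states `u_j` of `NS_{ν_j}(Φ•G)` (`Torus.IsSteadyNSState`) with
total momentum `c e₀` and energies `∫‖u_j‖²` bounded uniformly in `j`, along some `ν_j → 0⁺`. -/
def SteadyGridBranch : Prop :=
  ∃ (Φ : 𝕋³ → ℝ) (G : 𝕋³ → E³) (c : ℝ), Torus.IsSmooth Φ ∧ Torus.IsSmooth G ∧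
    (∀ (s : UnitAddCircle) x, Φ (x + Pi.single (1 : Fin 3) s) = Φ x ∧ Φ (x + Pi.single (2 : Fin 3) s) = Φ x) ∧
    (∫ x, Φ x = 1) ∧ (∀ (s : UnitAddCircle) x, G (x + Pi.single (0 : Fin 3) s) = G x) ∧ (∀ x, G x 0 = 0) ∧
    Torus.IsSmooth (fun x => Φ x • G x) ∧ Torus.IsDivFree (fun x => Φ x • G x) ∧
    Torus.HasZeroMean (fun x => Φ x • G x) ∧ (fun x => Φ x • G x) ≠ 0 ∧ 0 < c ∧
    ∃ (ν : ℕ → ℝ) (u : ℕ → 𝕋³ → E³) (p : ℕ → 𝕋³ → ℝ),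
      (∀ j, 0 < ν j) ∧ Tendsto ν atTop (nhds 0) ∧
      (∀ j, Torus.IsSteadyNSState (ν j) (fun x => Φ x • G x) (u j) (p j)) ∧
      (∀ j, ∫ x, u j x = c • EuclideanSpace.single 0 1) ∧
      ∃ E : ℝ, ∀ j, ∫ x, ‖u j x‖ ^ 2 ≤ E

/-- **FIRST LEMMA (transfer, proved): steady states are their own Leray–Hopf data.**
`Torus.IsSteadyNSState ν f u p` is `IsClassicalNSSolutionOn univ` on constant data, hence a global
Leray–Hopf solution from the datum `u` (`IsClassicalNSSolutionOn.isGlobalLerayHopf`, proved in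
`TorusClassicalLerayHopfProofs`), and the mean energy of a constant path is its energy
(`meanEnergy_eq_of_periodic` with period `1`). Size S. -/
theorem boundedEnergyGrid_of_steadyGridBranch :
    SteadyGridBranch → Summit.AnomalousDissipation.AnomalousDissipation.Theses.ImpulseGrid.BoundedEnergyGrid := by
  rintro ⟨Φ, G, c, hΦ, hG, hΦinv, hΦmass, hGinv, hG0, hfs, hfd, hfm, hfne, hc, ν, u, p, hν, hν0, hst,
    hmom, E, hE⟩
  refine ⟨Φ, G, c, hΦ, hG, hΦinv, hΦmass, hGinv, hG0, hfs, hfd, hfm, hfne, hc, ν, u, fun j _ => u j, hν,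
    hν0, fun j => (hst j).isGlobalLerayHopf, hmom, E, fun j => ?_⟩
  rw [meanEnergy_eq_of_periodic (τ := 1) (fun _ => rfl) one_pos]
  simpa using hE j

/-- **C⁺_col (columnar steady branch; the planar content in 3-D dress).** One smooth transverse
(`G·e₀ = 0`), `x₀`-invariant, divergence-free, mean-zero force `G ≠ 0` on `T³` admits, along some
`ν_j → 0⁺`, smooth steady states `V_j` of `NS_{ν_j}(G)` which are themselves `x₀`-invariant,
transverse and MEAN-ZERO, with `∫‖V_j‖²` bounded uniformly in `j`. -/
def ColumnarSteadyBranch : Prop :=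
  ∃ G : 𝕋³ → E³, Torus.IsSmooth G ∧ (∀ (s : UnitAddCircle) x, G (x + Pi.single (0 : Fin 3) s) = G x) ∧
    (∀ x, G x 0 = 0) ∧ Torus.IsDivFree G ∧ Torus.HasZeroMean G ∧ G ≠ 0 ∧
    ∃ (ν : ℕ → ℝ) (V : ℕ → 𝕋³ → E³) (p : ℕ → 𝕋³ → ℝ),
      (∀ j, 0 < ν j) ∧ Tendsto ν atTop (nhds 0) ∧
      (∀ j, Torus.IsSteadyNSState (ν j) G (V j) (p j)) ∧
      (∀ j (s : UnitAddCircle) x, V j (x + Pi.single (0 : Fin 3) s) = V j x) ∧ (∀ j x, V j x 0 = 0) ∧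
      (∀ j, Torus.HasZeroMean (V j)) ∧
      ∃ E : ℝ, ∀ j, ∫ x, ‖V j x‖ ^ 2 ≤ E

/-- **Galilean column lift** (size M, provable now): with `Φ ≡ 1` (smooth, `x⊥`-invariant, `∫ 1 = 1` on
the probability torus), `c := 1` and `u_j := e₀ + V_j`: `(u·∇)u = ∂₀V + (V·∇)V = (V·∇)V`
(`Torus.convect_add_left`, `Torus.convect_const_field`, `∂₀V = 0` from `x₀`-invariance), `Δ`, `div`
unchanged, so `u_j` is a steady state of `NS_{ν_j}(1•G)` with the same pressure;
`∫ u_j = e₀ + ∫V_j = e₀`; `∫‖u_j‖² = 1 + ∫‖V_j‖²` (cross term `2∫V_j·e₀ = 2∫(V_j)₀ = 0`). -/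
theorem steadyGridBranch_of_columnar : ColumnarSteadyBranch → SteadyGridBranch := by
  sorry

/-- **The archived planar C⁺** (verbatim `BoundedSteadyBranch` of
`Cruxes/TwodBoundedEnergyZeroMomentum/SketchIdeator2.lean`; the `∃g` form of the printed open problem
ConstantinTarfuleaVicol2013 p. 3): one steady smooth divergence-free mean-zero planar force `g ≠ 0`
admits mean-zero steady states of `NS_{ν_j}(g)` with bounded energy along `ν_j → 0⁺`. -/
def BoundedSteadyBranch₂ : Prop :=
  ∃ g : 𝕋² → E², Torus.IsSmooth g ∧ Torus.IsDivFree g ∧ Torus.HasZeroMean g ∧ g ≠ 0 ∧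
    ∃ (ν : ℕ → ℝ) (v : ℕ → 𝕋² → E²) (p : ℕ → 𝕋² → ℝ),
      (∀ j, 0 < ν j) ∧ Tendsto ν atTop (nhds 0) ∧
      (∀ j, Torus.IsSteadyNSState (ν j) g (v j) (p j)) ∧
      (∀ j, Torus.HasZeroMean (v j)) ∧
      ∃ E : ℝ, ∀ j, ∫ x, ‖v j x‖ ^ 2 ≤ E

/-- **Planar steady lift along `e₀`** (size M, provable now): `G := σ ∘ twoHalf g 0 ∘ σ⁻¹`,
`V_j := σ ∘ twoHalf (v j) 0 ∘ σ⁻¹` with `σ` the cyclic axis permutation taking the invariant direction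
`e₂` of `Torus.twoHalf` to `e₀` (`isClassicalNSSolutionOn_twoHalf` with `R = 0`, `φ = p`, steady data:
`twoHalfForce = twoHalf g 0`; `integral_norm_sq_twoHalf`; `hasZeroMean_twoHalf`; NS-equivariance under
the lattice isometry `σ`). Alternatively the planar lines are re-run directly in the `e₀`-columnar class. -/
theorem columnar_of_planar : BoundedSteadyBranch₂ → ColumnarSteadyBranch := by
  sorry

/-- **The transfer in one line**: the archived planar problem decides `BoundedEnergyGrid`. -/
theorem boundedEnergyGrid_of_planar :
    BoundedSteadyBranch₂ → Summit.AnomalousDissipation.AnomalousDissipation.Theses.ImpulseGrid.BoundedEnergyGrid :=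
  fun h => boundedEnergyGrid_of_steadyGridBranch (steadyGridBranch_of_columnar (columnar_of_planar h))

end Summit.AnomalousDissipation.AnomalousDissipation.Cruxes.BoundedEnergyGrid.ColumnarCollapse
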